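import Summits.KontsevichZagierPeriods.KontsevichZagierPeriods.Theorems.SoloBlindQuarticS3Prep
import Summits.KontsevichZagierPeriods.KontsevichZagierPeriods.Theorems.SoloBlindQuarticSecond
import HarnessLib

/-!
# Quartic family, second kind, pattern `(½+y, 1-4y, ½+3y)` — the relation in `Q` and the merge

Sol Binde (solo-blind track), 2026-08-20.

With the pulled-back integrands `G_A, G_B, G_C` and the primitive `P` of `SoloBlindQuarticS3Prep`
(`P' = ((1-6y)/2)G_B + ((1-2y)/2)G_A - (1+4y)64^{-y}G_C`, `P(0) = P(1) = 0`), the KZ chain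
three substitutions → one Newton–Leibniz move → two additivity splits gives, for every rational
`0 < y < 1/4`, the relation

  `((1-6y)/2) • β(½+y, 1-4y) + ((1-2y)/2) • β(1-4y, ½+3y) = (1+4y)·64^{-y} • β(½+3y, 1-y)`  (in `Q`),

all three Betas of the second kind (parameter sums `3/2-3y`, `3/2-y`, `3/2+2y`).  With the
second-kind orbit relation it merges the orbit of `{½+y, 1-4y, ½+3y}` with that of
`{½+3y, 1-y, ½-2y}`:  `β(½+y, 1-4y) ≐ β(½+3y, 1-y)`  (`0 < y < 1/6`).
Instances: levels `14`, `8`, `18`, `10`.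

Sources: Aoki–Shioda standard cycles (J. Math. Soc. Japan 39 (1987), doi:10.2969/jmsj/03930385);
the explicit one-dimensional realisation appears to be new.
-/

open MeasureTheory Set Real MvPolynomial
open Literature.NumberTheory.Transcendental
open Literature.NumberTheory.Transcendental.KZ
open Literature.NumberTheory.Transcendental.KZ.IntegralRep
open Literature.ModelTheory.ExponentialFields

noncomputable section

namespace Summit.KontsevichZagierPeriods.KontsevichZagierPeriods.Theorems

namespace SoloBlind

variable {y : ℚ}

/-! ## On the closed interval -/

/-- `P` is `ℚ`-semialgebraic on `[0,1]` (`0 < y < 1/4`). -/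
theorem sa_qiP (hy : 0 < y) (hy4 : 4 * y < 1) :
    IsSemialgebraicFunOn ℚ (line (Icc 0 1)) fun v => qiP y (v 0) := by
  refine isSemialgebraicFunOn_Icc_of_Ioo ?_ 0 0 (fun x hx => ?_) (fun x hx => ?_)
  · refine (sa_qi_shape y (X 0 * (X 0 ^ 4 - 2 * X 0 ^ 2 + 4 * X 0 - 3)) (1 + X 0 ^ 2)
      fun v _ => ?_).congr fun v hv => ?_
    · have : (0:ℝ) < 1 + v 0 ^ 2 := by positivity
      simpa using this.ne'
    · have hv' : v 0 ∈ Ioo (0:ℝ) 1 := hv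
      simp [qiP_eq hv', qiL, mul_div_assoc]
  · rw [hx, qiP_zero hy, Rat.cast_zero]
  · rw [hx, qiP_one hy4, Rat.cast_zero]

/-- The exact integrand is `ℚ`-semialgebraic on `[0,1]`. -/
theorem sa_qiE (y : ℚ) : IsSemialgebraicFunOn ℚ (line (Icc 0 1)) fun v => qiE y (v 0) := by
  refine isSemialgebraicFunOn_Icc_of_Ioo (sa_qiE_Ioo y) 0 0 (fun x hx => ?_) (fun x hx => ?_)
  · have h0 : x 0 ∉ Ioo (0:ℝ) 1 := fun h => by rw [hx] at h; exact lt_irrefl _ h.1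
    rw [qiE, if_neg h0, Rat.cast_zero]
  · have h0 : x 0 ∉ Ioo (0:ℝ) 1 := fun h => by rw [hx] at h; exact lt_irrefl _ h.2
    rw [qiE, if_neg h0, Rat.cast_zero]

/-- The exact integrand is integrable on `[0,1]`. -/
theorem integrableOn_qiE (hy : 0 < y) (hy4 : 4 * y < 1) : IntegrableOn (qiE y) (Icc 0 1) := by
  rw [integrableOn_Icc_iff_integrableOn_Ioo]
  exact IntegrableOn.congr_fun
    (((integrableOn_qiGC y hy (by linarith)).const_mul
      ((((-(1 + 4 * y)) : ℚ) : ℝ) * (64:ℝ) ^ (-(y : ℝ)))).add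
      (((integrableOn_qiGB y hy hy4).const_mul ((((1 - 6 * y) / 2 : ℚ)) : ℝ)).add
        ((integrableOn_qiGA y hy hy4).const_mul ((((1 - 2 * y) / 2 : ℚ)) : ℝ))))
    (fun v hv => by simp only [qiE, if_pos hv, Pi.add_apply]) measurableSet_Ioo

/-! ## The coefficient `κ_y = (1+4y)·64^{-y}` -/

/-- `κ_y` is algebraic. -/
theorem isAlgebraic_qiC (y : ℚ) :
    IsAlgebraic ℚ ((((1 + 4 * y : ℚ)) : ℝ) * (64:ℝ) ^ (-(y : ℝ))) := by
  have h := (isAlgebraic_rat ℚ (1 + 4 * y)).mul (qu_isAlgebraic_rpow (-y))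
  rwa [Rat.cast_neg] at h

/-- `κ_y` as an element of `K₀`. -/
def qiCK (y : ℚ) : K₀ :=
  ⟨(((1 + 4 * y : ℚ)) : ℝ) * (64:ℝ) ^ (-(y : ℝ)), mem_K₀_iff.mpr (isAlgebraic_qiC y)⟩

/-- `(κ_y : ℝ) = (1+4y)·64^{-y}`. -/
@[simp] theorem coe_qiCK (y : ℚ) :
    ((qiCK y : K₀) : ℝ) = (((1 + 4 * y : ℚ)) : ℝ) * (64:ℝ) ^ (-(y : ℝ)) := rfl

/-- `κ_y ≠ 0` for `0 < y`. -/
theorem qiCK_ne_zero (hy : 0 < y) : qiCK y ≠ 0 := by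
  intro h
  have h' := congrArg (fun z : K₀ => (z : ℝ)) h
  simp only [coe_qiCK, ZeroMemClass.coe_zero] at h'
  have h1 : (0:ℝ) < (((1 + 4 * y : ℚ)) : ℝ) := by
    have : (0:ℚ) < 1 + 4 * y := by linarith
    exact_mod_cast this
  have : (0:ℝ) < (((1 + 4 * y : ℚ)) : ℝ) * (64:ℝ) ^ (-(y : ℝ)) := by positivity
  linarith

/-! ## The representations and the moves -/

/-- `R_A = [(0,1), G_A]`. -/
def qiRA (y : ℚ) (hy : 0 < y) (hy4 : 4 * y < 1) : IntegralRep 1 :=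
  lineRep (Ioo 0 1) (qiGA y) mix_line_sa (sa_qiGA y) (integrableOn_qiGA y hy hy4)

/-- `R_B = [(0,1), G_B]`. -/
def qiRB (y : ℚ) (hy : 0 < y) (hy4 : 4 * y < 1) : IntegralRep 1 :=
  lineRep (Ioo 0 1) (qiGB y) mix_line_sa (sa_qiGB y) (integrableOn_qiGB y hy hy4)

/-- `R_C = [(0,1), G_C]`. -/
def qiRC (y : ℚ) (hy : 0 < y) (hy4 : 4 * y < 1) : IntegralRep 1 :=
  lineRep (Ioo 0 1) (qiGC y) mix_line_sa (sa_qiGC y) (integrableOn_qiGC y hy (by linarith))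

/-- The combination `W = ((1-6y)/2)·G_B + ((1-2y)/2)·G_A`. -/
def qiW (y : ℚ) (m : ℝ) : ℝ :=
  ((((1 - 6 * y) / 2 : ℚ)) : ℝ) * qiGB y m + ((((1 - 2 * y) / 2 : ℚ)) : ℝ) * qiGA y m

/-- `[(0,1), W]`. -/
def qiWRep (y : ℚ) (hy : 0 < y) (hy4 : 4 * y < 1) : IntegralRep 1 :=
  lineRep (Ioo 0 1) (qiW y) mix_line_sa
    (((isSemialgebraicFunOn_const_of_isAlgebraic mix_line_sa
      (isAlgebraic_rat ℚ ((1 - 6 * y) / 2))).mul_holds (sa_qiGB y)).add_holds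
      ((isSemialgebraicFunOn_const_of_isAlgebraic mix_line_sa
        (isAlgebraic_rat ℚ ((1 - 2 * y) / 2))).mul_holds (sa_qiGA y)))
    (((integrableOn_qiGB y hy hy4).const_mul _).add ((integrableOn_qiGA y hy hy4).const_mul _))

/-- `X = [[0,1], P']`. -/
def qiExact (y : ℚ) (hy : 0 < y) (hy4 : 4 * y < 1) : IntegralRep 1 :=
  lineRep (Icc 0 1) (qiE y) (isSemialgebraic_line_Icc isAlgebraic_zero isAlgebraic_one)
    (sa_qiE y) (integrableOn_qiE hy hy4)

/-- **Move A (substitution `σ = φ_A(m)`):** `R_A ≡ β(1-4y, ½+3y)`. -/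
theorem qiRA_sub_betaRep (y : ℚ) (hy : 0 < y) (hy4 : 4 * y < 1) :
    of (qiRA y hy hy4) - of (betaRep (1 - 4 * y) (1 / 2 + 3 * y) (by linarith) (by positivity)) ∈
      relations := by
  unfold qiRA betaRep
  exact lineRep_subst quA quA' sa_quA (fun m _ => (hasDerivAt_quA m).hasDerivWithinAt) injOn_quA
    image_quA (fun m hm => qi_pullA y hm)

/-- **Move B (substitution `σ = φ_B(m)`):** `R_B ≡ β(½+y, 1-4y)`. -/
theorem qiRB_sub_betaRep (y : ℚ) (hy : 0 < y) (hy4 : 4 * y < 1) :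
    of (qiRB y hy hy4) - of (betaRep (1 / 2 + y) (1 - 4 * y) (by positivity) (by linarith)) ∈
      relations := by
  unfold qiRB betaRep
  exact lineRep_subst quB quB' sa_quB (fun m _ => (hasDerivAt_quB m).hasDerivWithinAt) injOn_quB
    image_quB (fun m hm => qi_pullB y hm)

/-- **Move C (substitution `s = ψ(m)`):** `R_C ≡ β(½+3y, 1-y)`. -/
theorem qiRC_sub_betaRep (y : ℚ) (hy : 0 < y) (hy4 : 4 * y < 1) :
    of (qiRC y hy hy4) - of (betaRep (1 / 2 + 3 * y) (1 - y) (by positivity) (by linarith)) ∈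
      relations := by
  unfold qiRC betaRep
  exact lineRep_subst quS quS' sa_quS (fun m _ => (hasDerivAt_quS m).hasDerivWithinAt) injOn_quS
    image_quS (fun m hm => qi_pullC y hm)

/-- **Move D, rule (3) (Newton–Leibniz):** `[[0,1], P'] ∈ relations`, since `P(1) - P(0) = 0`. -/
theorem qiExact_mem (y : ℚ) (hy : 0 < y) (hy4 : 4 * y < 1) :
    of (qiExact y hy hy4) ∈ relations := by
  have h0 : qiP y 1 - qiP y 0 = 0 := by rw [qiP_one hy4, qiP_zero hy, sub_zero]
  have h1 : of (qiExact y hy hy4) -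
      of (constCell (qiP y 1 - qiP y 0) (by rw [h0]; exact isAlgebraic_zero)) ∈ relations :=
    lineRep_newtonLeibniz isAlgebraic_zero isAlgebraic_one zero_le_one (qiP y)
      (sa_qiP hy hy4) (continuous_qiP hy hy4).continuousOn
      fun t ht => hasDerivAt_qiP ht
  have hc : of (constCell (qiP y 1 - qiP y 0) (by rw [h0]; exact isAlgebraic_zero)) ∈
      relations := by
    rw [constCell_congr h0 (hβ := isAlgebraic_zero)]
    exact constCell_zero
  simpa using relations.add_mem h1 hc

/-- `X⁰ = [(0,1), P']`, the open restriction. -/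
def qiExactO (y : ℚ) (hy : 0 < y) (hy4 : 4 * y < 1) : IntegralRep 1 :=
  (qiExact y hy hy4).restrict (line (Ioo 0 1)) mix_line_sa fun _ hx => Ioo_subset_Icc_self hx

/-- `[(0,1), P'] ∈ relations`. -/
theorem qiExactO_mem (y : ℚ) (hy : 0 < y) (hy4 : 4 * y < 1) :
    of (qiExactO y hy hy4) ∈ relations := by
  have h1 : of (qiExact y hy hy4) - of (qiExactO y hy hy4) ∈ relations := by
    refine IntegralRep.of_sub_of_restrict_mem_relations _ _ _ ?_
    show volume (line (Icc (0 : ℝ) 1) \ line (Ioo 0 1)) = 0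
    rw [← show line (Icc (0 : ℝ) 1 \ Ioo 0 1) = line (Icc (0 : ℝ) 1) \ line (Ioo 0 1) from rfl,
      volume_line, Icc_sdiff_Ioo_same zero_le_one]
    exact (toFinite _).measure_zero _
  have h2 := relations.sub_mem (qiExact_mem y hy hy4) h1
  rwa [sub_sub_cancel] at h2

/-- **Move E, rule (1b):** `[(0,1), W] ≡ κ_y•R_C + [(0,1), P']`. -/
theorem qiWRep_sub_sub_exact (y : ℚ) (hy : 0 < y) (hy4 : 4 * y < 1) :
    of (qiWRep y hy hy4) - of ((qiRC y hy hy4).constMul _ (isAlgebraic_qiC y)) -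
      of (qiExactO y hy hy4) ∈ relations := by
  refine of_sub_sub_mem_relations_of_add rfl rfl fun x hx => ?_
  have hx' : x 0 ∈ Ioo (0 : ℝ) 1 := hx
  simp only [qiExactO, IntegralRep.integrand_restrict, qiExact, lineRep_integrand,
    IntegralRep.integrand_constMul, qiRC, qiWRep]
  rw [qiE, if_pos hx', qiW]
  push_cast
  ring

/-- **Move F, rule (1b):** `[(0,1), W] ≡ ((1-6y)/2)•R_B + ((1-2y)/2)•R_A`. -/
theorem qiWRep_sub_sub (y : ℚ) (hy : 0 < y) (hy4 : 4 * y < 1) :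
    of (qiWRep y hy hy4) -
      of ((qiRB y hy hy4).constMul ((((1 - 6 * y) / 2 : ℚ)) : ℝ)
        (isAlgebraic_rat ℚ ((1 - 6 * y) / 2))) -
      of ((qiRA y hy hy4).constMul ((((1 - 2 * y) / 2 : ℚ)) : ℝ)
        (isAlgebraic_rat ℚ ((1 - 2 * y) / 2))) ∈ relations :=
  of_sub_sub_mem_relations_of_add rfl rfl fun _ _ => rfl

/-! ## Assembly in `Q` -/

/-- `[R_A] = β(1-4y, ½+3y)`. -/
theorem qiRA_eq (y : ℚ) (hy : 0 < y) (hy4 : 4 * y < 1) :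
    mkQ (of (qiRA y hy hy4)) = betaQ (1 - 4 * y) (1 / 2 + 3 * y) := by
  rw [betaQ_eq (by linarith) (by positivity)]
  exact mkQ_eq_mkQ_iff.mpr (qiRA_sub_betaRep y hy hy4)

/-- `[R_B] = β(½+y, 1-4y)`. -/
theorem qiRB_eq (y : ℚ) (hy : 0 < y) (hy4 : 4 * y < 1) :
    mkQ (of (qiRB y hy hy4)) = betaQ (1 / 2 + y) (1 - 4 * y) := by
  rw [betaQ_eq (by positivity) (by linarith)]
  exact mkQ_eq_mkQ_iff.mpr (qiRB_sub_betaRep y hy hy4)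

/-- `[R_C] = β(½+3y, 1-y)`. -/
theorem qiRC_eq (y : ℚ) (hy : 0 < y) (hy4 : 4 * y < 1) :
    mkQ (of (qiRC y hy hy4)) = betaQ (1 / 2 + 3 * y) (1 - y) := by
  rw [betaQ_eq (by positivity) (by linarith)]
  exact mkQ_eq_mkQ_iff.mpr (qiRC_sub_betaRep y hy hy4)

/-- `[(0,1), W] = ((1-6y)/2)•β(½+y,1-4y) + ((1-2y)/2)•β(1-4y,½+3y)` in `Q`. -/
theorem mkQ_qiWRep (y : ℚ) (hy : 0 < y) (hy4 : 4 * y < 1) :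
    mkQ (of (qiWRep y hy hy4)) =
      (((1 - 6 * y) / 2 : ℚ) : K₀) • betaQ (1 / 2 + y) (1 - 4 * y) +
        (((1 - 2 * y) / 2 : ℚ) : K₀) • betaQ (1 - 4 * y) (1 / 2 + 3 * y) := by
  have h1 := qiWRep_sub_sub y hy hy4
  rw [sub_sub] at h1
  have h2 := mkQ_eq_mkQ_iff.mpr h1
  rwa [map_add, mkQ_constMul_ratCast, mkQ_constMul_ratCast, qiRB_eq, qiRA_eq] at h2

/-- `[(0,1), W] = κ_y • β(½+3y, 1-y)` in `Q`. -/
theorem mkQ_qiWRep_eq_C (y : ℚ) (hy : 0 < y) (hy4 : 4 * y < 1) :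
    mkQ (of (qiWRep y hy hy4)) = qiCK y • betaQ (1 / 2 + 3 * y) (1 - y) := by
  have h1 := relations.add_mem (qiWRep_sub_sub_exact y hy hy4) (qiExactO_mem y hy hy4)
  rw [sub_add_cancel] at h1
  have h2 := mkQ_eq_mkQ_iff.mpr h1
  rw [mkQ_constMul, qiRC_eq] at h2
  exact h2

/-- **The third second-kind quartic family inside the Kontsevich–Zagier rules:**
`((1-6y)/2) • β(½+y, 1-4y) + ((1-2y)/2) • β(1-4y, ½+3y) = (1+4y)·64^{-y} • β(½+3y, 1-y)` for
rational `0 < y < 1/4` — three substitutions, ONE Newton–Leibniz move, two additivity splits. -/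
theorem betaQ_quarticS3 (y : ℚ) (hy : 0 < y) (hy4 : 4 * y < 1) :
    (((1 - 6 * y) / 2 : ℚ) : K₀) • betaQ (1 / 2 + y) (1 - 4 * y) +
        (((1 - 2 * y) / 2 : ℚ) : K₀) • betaQ (1 - 4 * y) (1 / 2 + 3 * y) =
      qiCK y • betaQ (1 / 2 + 3 * y) (1 - y) := by
  rw [← mkQ_qiWRep y hy hy4, mkQ_qiWRep_eq_C y hy hy4]

/-- Period check: `((1-6y)/2)B(½+y,1-4y) + ((1-2y)/2)B(1-4y,½+3y) = (1+4y)64^{-y}B(½+3y,1-y)`. -/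
theorem beta_quarticS3_value (y : ℚ) (hy : 0 < y) (hy4 : 4 * y < 1) :
    (1 - 6 * (y : ℝ)) / 2 * evalQ (betaQ (1 / 2 + y) (1 - 4 * y)) +
        (1 - 2 * (y : ℝ)) / 2 * evalQ (betaQ (1 - 4 * y) (1 / 2 + 3 * y)) =
      (1 + 4 * (y : ℝ)) * (64:ℝ) ^ (-(y : ℝ)) * evalQ (betaQ (1 / 2 + 3 * y) (1 - y)) := by
  have h := congrArg evalQ (betaQ_quarticS3 y hy hy4)
  rw [map_add, evalQ_smul, evalQ_smul, evalQ_smul, coe_qiCK] at h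
  push_cast at h
  exact h

/-! ## The orbit merge -/

/-- **Third second-kind quartic merge: `β(½+y, 1-4y) ≐ β(½+3y, 1-y)`** for rational
`0 < y < 1/6`: the orbit of `{½+y, 1-4y, ½+3y}` meets that of `{½+3y, 1-y, ½-2y}`.  Precisely
`((1-6y)(1-2y)/4)(sin π(½+3y) + sin π(½+y)) • β(½+y, 1-4y) = ((½-y) sin π(½+3y) κ_y) • β(½+3y, 1-y)`.
-/
theorem betaQ_propTo_quarticS3 (y : ℚ) (hy : 0 < y) (hy6 : 6 * y < 1) :
    PropTo (betaQ (1 / 2 + y) (1 - 4 * y)) (betaQ (1 / 2 + 3 * y) (1 - y)) := by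
  have hy4 : 4 * y < 1 := by linarith
  have key := betaQ_quarticS3 y hy hy4
  -- second-kind orbit relation inside `{1-4y, ½+y, ½+3y}`
  have hp := betaQ_second_rat (1 / 2 + 3 * y) (1 / 2 + y) (by linarith) (by linarith)
    (by linarith)
  rw [show (2:ℚ) - (1 / 2 + 3 * y) - (1 / 2 + y) = 1 - 4 * y by ring,
    betaQ_symm (show (0:ℚ) < 1 / 2 + 3 * y by positivity) (show (0:ℚ) < 1 - 4 * y by linarith)]
    at hp
  -- hp : (1-(½+y)) • sinQ(½+3y) • β(1-4y, ½+3y) = (1-(½+3y)) • sinQ(½+y) • β(½+y, 1-4y)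
  refine PropTo.of_smul_eq_smul
    (c := (((1 - 6 * y) * (1 - 2 * y) / 4 : ℚ) : K₀) * (sinQ (1 / 2 + 3 * y) + sinQ (1 / 2 + y)))
    (c' := ((1 - (1 / 2 + y) : ℚ) : K₀) * sinQ (1 / 2 + 3 * y) * qiCK y)
    (mul_ne_zero (by exact_mod_cast (show ((1 - 6 * y) * (1 - 2 * y) / 4 : ℚ) ≠ 0 by
        have h1 : (1 - 6 * y : ℚ) ≠ 0 := by linarith
        have h2 : (1 - 2 * y : ℚ) ≠ 0 := by linarith
        positivity))
      (sinQ_add_sinQ_ne_zero (by positivity) (by linarith) (by positivity) (by linarith)))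
    (mul_ne_zero (mul_ne_zero (by exact_mod_cast (show (1 - (1 / 2 + y) : ℚ) ≠ 0 by linarith))
      (sinQ_ne_zero (by positivity) (by linarith))) (qiCK_ne_zero hy)) ?_
  have key' := congrArg (fun z => (((1 - (1 / 2 + y) : ℚ) : K₀) * sinQ (1 / 2 + 3 * y)) • z) key
  simp only [smul_add, ← smul_assoc, smul_eq_mul] at key'
  have hp' := congrArg (fun z => (((1 - 2 * y) / 2 : ℚ) : K₀) • z) hp
  simp only [← smul_assoc, smul_eq_mul] at hp'
  have e1 : ((1 - (1 / 2 + y) : ℚ) : K₀) * sinQ (1 / 2 + 3 * y) * (((1 - 2 * y) / 2 : ℚ) : K₀) =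
      (((1 - 2 * y) / 2 : ℚ) : K₀) * (((1 - (1 / 2 + y) : ℚ) : K₀) * sinQ (1 / 2 + 3 * y)) := by
    ring
  rw [e1, hp'] at key'
  have e2 : (((1 - 6 * y) * (1 - 2 * y) / 4 : ℚ) : K₀) * (sinQ (1 / 2 + 3 * y) + sinQ (1 / 2 + y)) =
      ((1 - (1 / 2 + y) : ℚ) : K₀) * sinQ (1 / 2 + 3 * y) * (((1 - 6 * y) / 2 : ℚ) : K₀) +
        (((1 - 2 * y) / 2 : ℚ) : K₀) * (((1 - (1 / 2 + 3 * y) : ℚ) : K₀) * sinQ (1 / 2 + y)) := by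
    push_cast
    ring
  rw [e2, add_smul]
  exact key'

/-! ## Instances -/

/-- Level `14` (`y = 1/7`): `β(9/14, 3/7) ≐ β(13/14, 6/7)` — `{6,9,13}` meets `{3,12,13}`. -/
theorem betaQ_propTo_fourteen_qi :
    PropTo (betaQ (9 / 14) (3 / 7)) (betaQ (13 / 14) (6 / 7)) := by
  have h := betaQ_propTo_quarticS3 (1 / 7) (by norm_num) (by norm_num)
  norm_num at h
  exact h

/-- Level `8` (`y = 1/8`): `β(5/8, 1/2) ≐ β(7/8, 7/8)` — `{4,5,7}` meets `{2,7,7}`. -/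
theorem betaQ_propTo_eight_qi : PropTo (betaQ (5 / 8) (1 / 2)) (betaQ (7 / 8) (7 / 8)) := by
  have h := betaQ_propTo_quarticS3 (1 / 8) (by norm_num) (by norm_num)
  norm_num at h
  exact h

/-- Level `18` (`y = 1/9`): `β(11/18, 5/9) ≐ β(5/6, 8/9)` — `{10,11,15}` meets `{5,15,16}`. -/
theorem betaQ_propTo_eighteen_qi :
    PropTo (betaQ (11 / 18) (5 / 9)) (betaQ (5 / 6) (8 / 9)) := by
  have h := betaQ_propTo_quarticS3 (1 / 9) (by norm_num) (by norm_num)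
  norm_num at h
  exact h

/-- Level `10` (`y = 1/10`): `β(3/5, 3/5) ≐ β(4/5, 9/10)` — `{6,6,8}` meets `{3,8,9}`. -/
theorem betaQ_propTo_ten_qi : PropTo (betaQ (3 / 5) (3 / 5)) (betaQ (4 / 5) (9 / 10)) := by
  have h := betaQ_propTo_quarticS3 (1 / 10) (by norm_num) (by norm_num)
  norm_num at h
  exact h

end SoloBlind

end Summit.KontsevichZagierPeriods.KontsevichZagierPeriods.Theorems
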